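import Literature.NumberTheory.GaloisRepresentations.ContinuousH2
import Literature.NumberTheory.GaloisRepresentations.GaloisCohomology
import Literature.NumberTheory.GaloisRepresentations.BrauerTower
import HarnessLib

/-!
# Explicit `ℤ/n`-valued locally constant `2`-cocycles on a subgroup vs. `H²(U, μ_n)`

Topic `NumberTheory/GaloisRepresentations`; namespace
`Literature.NumberTheory.GaloisRepresentations.ExplicitMuCocycles`.  Proof file: theorems only (no
definition, no instance, no named fact).

Bridge between the two cochain languages of the tree, for a field `F`, a closed subgroup
`U ≤ Γ_F` acting TRIVIALLY on `μ_n(F̄)` and an identification `e : ℤ/n ≃ μ_n(F̄)`: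
the "explicit" model of `TateLocalH2Nonvanishing.lean` / `LocallyConstantCocyclesClosedSubgroups.lean`
(total functions `f : Γ_F → Γ_F → ZMod n`, locally constant on `U × U`, with
`f a b + f (a b) c = f b c + f a (b c)` and coboundaries `β a + β b - β (a b)` on `U`) and the
tree's `continuousCohomology 2 ((mu F n).restrict (subgroupIncl U)).toTopRep` with its continuous
inhomogeneous cocycles `contTwoCocycles` / classes `twoCocycleClass` (`ContinuousH2.lean`):

* `exists_contTwoCocycle` — `f ↦ c_f`, `c_f (s, t) = e (f s t)`;
* `twoCocycleClass_eq_zero_iff_explicit` — `[c_f] = 0 ↔ f` is an explicit coboundary on `U`;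
* `exists_explicit_of_contTwoCocycle` — every continuous cocycle is a `c_f`;
* `contTwoCocycle_sub_nsmul` — `c_{g - k f} = c_g - k • c_f`;
* `pullback_inclHom_eq` / `resSub_twoCocycleClass_explicit` — restriction to `U' ≤ U` of `[c_f]`
  is the class of the same `f` on `U'`.

(Serre, *Cohomologie galoisienne* I §2.2–2.3: `H²` as classes of continuous factor systems; the
identification `ℤ/n ≅ μ_n` of trivial modules.)  Written for the number-field instantiation of the
abstract Neukirch lemma (`NeukirchAbstract*.lean`; abc-iut GAP-LEDGER G-L4d2g4-1, campaign L).

## References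

* J.-P. Serre, *Galois Cohomology* (1997), I §2.2–§2.3. [SerreGaloisCohomology1997]
-/

noncomputable section

open CategoryTheory Function

universe u

namespace Literature.NumberTheory.GaloisRepresentations.ExplicitMuCocycles

open Literature.NumberTheory.GaloisRepresentations
open _root_.TopRep _root_.ContRepresentation _root_.ContinuousCohomology Field DiscreteGaloisModule

variable {F : Type u} [Field F] [CharZero F] {n : ℕ}
variable (U : Subgroup (absoluteGaloisGroup F)) [IsClosed (U : Set (absoluteGaloisGroup F))]
variable (e : ZMod n ≃+ MuCarrier F n)
variable (hU : ∀ σ ∈ U, ∀ z : MuCarrier F n, mu F n σ z = z)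

include hU

omit [CharZero F] [IsClosed (U : Set (absoluteGaloisGroup F))] in
/-- **From an explicit cocycle to a continuous cocycle**: a `ZMod n`-valued function `f`, locally
constant on `U × U` and satisfying the `2`-cocycle identity on `U`, defines a continuous
inhomogeneous `2`-cocycle `c_f` of the (trivial) `U`-module `μ_n(F̄)` with `c_f (s, t) = e (f s t)`.
[cite: SerreGaloisCohomology1997, I §2.3] -/
theorem exists_contTwoCocycle (f : absoluteGaloisGroup F → absoluteGaloisGroup F → ZMod n)
    (hlc : IsLocallyConstant (fun q : U × U => f q.1 q.2))
    (hcoc : ∀ a ∈ U, ∀ b ∈ U, ∀ c ∈ U, f a b + f (a * b) c = f b c + f a (b * c)) :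
    ∃ c : contTwoCocycles ((mu F n).restrict (subgroupIncl U)).toTopRep,
      ∀ s t : U, c.1 (s, t) = e (f s t) := by
  let F2 : C(U × U, MuCarrier F n) := ⟨fun q => e (f q.1 q.2), (hlc.comp e).continuous⟩
  have hmem : F2 ∈ contTwoCocycles ((mu F n).restrict (subgroupIncl U)).toTopRep := by
    rw [mem_contTwoCocycles_iff]
    intro σ τ υ
    change ((mu F n).restrict (subgroupIncl U)).toTopRep.ρ σ (e (f τ υ)) + e (f σ (τ * υ)) =
      e (f (σ * τ) υ) + e (f σ τ)
    rw [ContinuousRep.toTopRep_ρ_apply, ContinuousRep.restrict_apply, subgroupIncl_apply,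
      hU σ σ.2, ← map_add, ← map_add]
    congr 1
    have key := hcoc σ σ.2 τ τ.2 υ υ.2
    linear_combination -key
  exact ⟨⟨F2, hmem⟩, fun s t => rfl⟩

/-- **`[c_f] = 0` iff `f` is an explicit coboundary on `U`** (a continuous bounding cochain
`b : U → μ_n` is the same as a locally constant `β : Γ_F → ZMod n` on `U`, `β = e⁻¹ ∘ b`; the
action of `U` on `μ_n` is trivial). [cite: SerreGaloisCohomology1997, I §2.3] -/
theorem twoCocycleClass_eq_zero_iff_explicit
    (f : absoluteGaloisGroup F → absoluteGaloisGroup F → ZMod n)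
    (c : contTwoCocycles ((mu F n).restrict (subgroupIncl U)).toTopRep)
    (hc : ∀ s t : U, c.1 (s, t) = e (f s t)) :
    twoCocycleClass _ c = 0 ↔
      ∃ β : absoluteGaloisGroup F → ZMod n, IsLocallyConstant (fun s : U => β s) ∧
        ∀ a ∈ U, ∀ b ∈ U, f a b = β a + β b - β (a * b) := by
  classical
  haveI : CompactSpace U := compactSpace_of_isClosed_subgroup
  rw [twoCocycleClass_eq_zero_iff]
  constructor
  · rintro ⟨b, hb⟩
    refine ⟨fun g => if hg : g ∈ U then e.symm (b ⟨g, hg⟩) else 0, ?_, fun a ha b' hb' => ?_⟩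
    · have h1 : IsLocallyConstant (b : U → MuCarrier F n) :=
        (IsLocallyConstant.iff_continuous _).2 b.continuous
      have h2 := h1.comp e.symm
      convert h2 using 1
      ext s
      simp [s.2]
    · have key := hb ⟨a, ha⟩ ⟨b', hb'⟩
      rw [hc, ContinuousRep.toTopRep_ρ_apply, ContinuousRep.restrict_apply, subgroupIncl_apply,
        hU a ha] at key
      apply e.injective
      simp only [dif_pos ha, dif_pos hb', dif_pos (U.mul_mem ha hb'), map_add, map_sub,
        AddEquiv.apply_symm_apply]
      have e1 : (⟨a * b', U.mul_mem ha hb'⟩ : U) = ⟨a, ha⟩ * ⟨b', hb'⟩ := rfl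
      rw [key, e1]
      abel
  · rintro ⟨β, hβ, hf⟩
    refine ⟨⟨fun s => e (β s), (hβ.comp e).continuous⟩, fun σ τ => ?_⟩
    rw [hc, ContinuousRep.toTopRep_ρ_apply, ContinuousRep.restrict_apply, subgroupIncl_apply,
      hU σ σ.2]
    change e (f σ τ) = e (β τ) - e (β (σ * τ : U)) + e (β σ)
    rw [hf σ σ.2 τ τ.2, Subgroup.coe_mul, map_sub, map_add]
    abel

omit [CharZero F] [IsClosed (U : Set (absoluteGaloisGroup F))] in
/-- **Every continuous cocycle is a `c_f`**: given `c ∈ Z²_cont(U, μ_n)`, the function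
`f = e⁻¹ ∘ c` (extended by `0` off `U × U`) is an explicit cocycle with `c = c_f`.
[cite: SerreGaloisCohomology1997, I §2.3] -/
theorem exists_explicit_of_contTwoCocycle
    (c : contTwoCocycles ((mu F n).restrict (subgroupIncl U)).toTopRep) :
    ∃ f : absoluteGaloisGroup F → absoluteGaloisGroup F → ZMod n,
      IsLocallyConstant (fun q : U × U => f q.1 q.2) ∧
      (∀ a ∈ U, ∀ b ∈ U, ∀ c' ∈ U, f a b + f (a * b) c' = f b c' + f a (b * c')) ∧
      ∀ s t : U, c.1 (s, t) = e (f s t) := by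
  classical
  refine ⟨fun a b => if ha : a ∈ U then (if hb : b ∈ U then e.symm (c.1 (⟨a, ha⟩, ⟨b, hb⟩)) else 0)
    else 0, ?_, ?_, ?_⟩
  · have h1 : IsLocallyConstant (fun q : U × U => c.1 q) :=
      (IsLocallyConstant.iff_continuous _).2 c.1.continuous
    have h2 := h1.comp e.symm
    convert h2 using 1
    ext q
    simp [q.1.2, q.2.2]
  · intro a ha b hb c' hc'
    have key := c.2 ⟨a, ha⟩ ⟨b, hb⟩ ⟨c', hc'⟩
    rw [ContinuousRep.toTopRep_ρ_apply, ContinuousRep.restrict_apply, subgroupIncl_apply,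
      hU a ha] at key
    apply e.injective
    simp only [dif_pos ha, dif_pos hb, dif_pos hc', dif_pos (U.mul_mem ha hb), dif_pos (U.mul_mem hb hc'),
      map_add, AddEquiv.apply_symm_apply]
    have e1 : (⟨a * b, U.mul_mem ha hb⟩ : U) = ⟨a, ha⟩ * ⟨b, hb⟩ := rfl
    have e2 : (⟨b * c', U.mul_mem hb hc'⟩ : U) = ⟨b, hb⟩ * ⟨c', hc'⟩ := rfl
    rw [e1, e2, add_comm]
    exact key.symm
  · intro s t
    simp [s.2, t.2]

omit [CharZero F] [IsClosed (U : Set (absoluteGaloisGroup F))] hU in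
/-- **Linearity**: `c_g - k • c_f` is the continuous cocycle of `g - k f`.
[cite: SerreGaloisCohomology1997, I §2.3] -/
theorem contTwoCocycle_sub_nsmul (f g : absoluteGaloisGroup F → absoluteGaloisGroup F → ZMod n)
    (cf cg : contTwoCocycles ((mu F n).restrict (subgroupIncl U)).toTopRep)
    (hcf : ∀ s t : U, cf.1 (s, t) = e (f s t)) (hcg : ∀ s t : U, cg.1 (s, t) = e (g s t)) (k : ℕ) :
    ∀ s t : U, (cg - k • cf).1 (s, t) = e (g s t - (k : ZMod n) * f s t) := by
  intro s t
  change cg.1 (s, t) - k • cf.1 (s, t) = _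
  rw [hcf, hcg, map_sub, ← nsmul_eq_mul, map_nsmul]

omit hU in
/-- **Restriction**: for `U' ≤ U`, the pull-back of `c_f` along the inclusion is the continuous
cocycle of the same `f` on `U'`; hence `res [c_f] = [c_f|_{U'}]`.
[cite: SerreGaloisCohomology1997, I §2.4] -/
theorem resSub_twoCocycleClass_explicit {U' : Subgroup (absoluteGaloisGroup F)}
    [IsClosed (U' : Set (absoluteGaloisGroup F))] (h : U' ≤ U)
    (f : absoluteGaloisGroup F → absoluteGaloisGroup F → ZMod n)
    (c : contTwoCocycles ((mu F n).restrict (subgroupIncl U)).toTopRep)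
    (hc : ∀ s t : U, c.1 (s, t) = e (f s t))
    (c' : contTwoCocycles ((mu F n).restrict (subgroupIncl U')).toTopRep)
    (hc' : ∀ s t : U', c'.1 (s, t) = e (f s t)) :
    resSub (mu F n) h 2 (twoCocycleClass _ c) = twoCocycleClass _ c' := by
  haveI : CompactSpace U := compactSpace_of_isClosed_subgroup
  haveI : CompactSpace U' := compactSpace_of_isClosed_subgroup
  unfold resSub
  rw [map_twoCocycleClass]
  congr 1
  refine Subtype.ext (ContinuousMap.ext fun q => ?_)
  obtain ⟨s, t⟩ := q
  rw [contTwoCocycles.pullback_apply, resSubMod_hom_apply, inclHom_apply, inclHom_apply, hc', hc]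
  rfl

end Literature.NumberTheory.GaloisRepresentations.ExplicitMuCocycles

end
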